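import Literature.AlgebraicGeometry.Modules.BoxTensorAffineSectionsSecMod
import Literature.Algebra.Homology.OrderedCechSystemBicomplex
import Literature.Algebra.Homology.OrderedCechPairSystemMap
import HarnessLib

/-!
# The Čech bicomplex of `E ⊠ F` on the product of two affine covers is `Č(𝓤, E) ⊗_A Č(𝓥, F)` (Stacks 0BEC)

Layer `Literature/AlgebraicGeometry/Modules` (constructions + proved lemmas; 0 named facts, no instance, no notation). Setting
(The Stacks Project, Tag 0BEC, proof of the Künneth formula over an affine base): an AFFINE base `S`, a ring `φ : A ≃+* Γ(S, ⊤)`,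
a cartesian square `p : Z → X`, `q : Z → Y` over `S`, finite linearly ordered open covers `𝓤` of `X`, `𝓥` of `Y` with AFFINE
finite intersections `U_s`, `V_t` (non-empty `s`, `t`), quasi-coherent `E` on `X`, `F` on `Y`; then `p⁻¹U_s ∩ q⁻¹V_t = U_s ×_S V_t`
and `Γ(U_s ×_S V_t, E ⊠ F) ≅ Γ(U_s, E) ⊗_A Γ(V_t, F)` naturally (rows `Modules/BoxTensorAffineSections(SecMod)`; Görtz–Wedhorn I
Prop. 4.17, Prop. 7.24 (2), Cor. 7.19 (4)).

* `boxSectionsSystem 𝓤 𝓥 G ρ` — the pair-system `(s, t) ↦ Γ(G, p⁻¹U_s ∩ q⁻¹V_t)` (`SecMod` of `Modules/ModuleCechComplex`) of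
  an `𝒪_Z`-module `G`; `cechBoxBicomplex … = OrderedCech.sysBicomplex (boxSectionsSystem …)` — the Čech double complex
  `Čᵃ,ᵇ = Π_τ Π_σ Γ(G, p⁻¹U_σ ∩ q⁻¹V_τ)` (`Algebra/Homology/OrderedCechPairSystem`);
* **`cechBoxBicomplexIso`** — `Č•,•(Γ(𝓤, E) ⊠ Γ(𝓥, F)) ≅ Č•,•(p⁻¹𝓤, q⁻¹𝓥; E ⊠ F)` (`sysBicomplexIsoNE` of
  `Algebra/Homology/OrderedCechPairSystemMap` on the isomorphisms `boxTensorSecModEquiv`, natural by `boxTensorSecModEquiv_natural`);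
* **`cechTensorIsoTotal : Č(𝓤, E) ⊗_A Č(𝓥, F) ≅ Tot Č•,•(p⁻¹𝓤, q⁻¹𝓥; E ⊠ F)`** — Mathlib's tensor product of the module Čech
  complexes IS the total complex of the Čech bicomplex of `E ⊠ F` (`totalTensorIso` of `Algebra/Homology/OrderedCechSystemBicomplex`
  + `HomologicalComplex₂.total.mapIso`). The comparison of `Tot` with `RΓ(Z, E ⊠ F)` is NOT in this file.

Library only (cell `pub-hodge-ring2`, count-neutral); proves nothing about any crux, route or conjecture.

## References

* The Stacks Project, Tag 0BEC (Künneth formula; the Čech double complex of the product covering), Tag 012K, Tag 01I8. [StacksProject]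
* U. Görtz, T. Wedhorn, *Algebraic Geometry I*, 2nd ed. (2020), Prop. 4.17, Cor. 7.19 (4), Prop. 7.24 (2). [GortzWedhorn2020]
* U. Görtz, T. Wedhorn, *Algebraic Geometry II* (2023), Def. 21.64, Def. 21.68 (pp. 179–180). [GortzWedhorn2023]
-/

universe u

open CategoryTheory AlgebraicGeometry MonoidalCategory TensorProduct
open Literature.Algebra.Homology Literature.Algebra.Homology.OrderedCech

set_option backward.isDefEq.respectTransparency false -- `Scheme.Modules` is not reducible (as in Mathlib)

noncomputable section

namespace Literature.AlgebraicGeometry.Modules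

variable {X Y Z S : Scheme.{u}} {p : Z ⟶ X} {q : Z ⟶ Y} {iX : X ⟶ S} {iY : Y ⟶ S} {A : Type u} [CommRing A]
  {ι κ : Type} (𝓤 : ι → X.Opens) (𝓥 : κ → Y.Opens)

section System

variable (p q) (G : Z.Modules) (ρ : A →+* Γ(Z, ⊤))

/-- `p⁻¹U_{s'} ∩ q⁻¹V_{t'} ≤ p⁻¹U_s ∩ q⁻¹V_t` for `s ⊆ s'`, `t ⊆ t'`. [cite: GortzWedhorn2023, Def. 21.64 (p. 179)] -/
theorem boxOpen_anti {s s' : Finset ι} {t t' : Finset κ} (hs : s ⊆ s') (ht : t ⊆ t') :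
    p ⁻¹ᵁ cechOpen 𝓤 s' ⊓ q ⁻¹ᵁ cechOpen 𝓥 t' ≤ p ⁻¹ᵁ cechOpen 𝓤 s ⊓ q ⁻¹ᵁ cechOpen 𝓥 t :=
  inf_le_inf (Scheme.Hom.preimage_mono p (cechOpen_anti 𝓤 hs)) (Scheme.Hom.preimage_mono q (cechOpen_anti 𝓥 ht))

/-- **The pair-system `(s, t) ↦ Γ(G, p⁻¹U_s ∩ q⁻¹V_t)`** of `A`-modules (through `ρ : A → Γ(Z, ⊤)`, the `SecMod` of
`Modules/ModuleCechComplex`) of an `𝒪_Z`-module `G` for two families of opens `𝓤` of `X`, `𝓥` of `Y` pulled back along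
`p`, `q`, with the restriction maps in both variables. [cite: StacksProject, Tag 0BEC] [cite: GortzWedhorn2023, Def. 21.64 (p. 179)] -/
def boxSectionsSystem : Finset ι ⥤ Finset κ ⥤ ModuleCat.{u} A where
  obj s :=
    { obj := fun t => ModuleCat.of A (SecMod G ρ (p ⁻¹ᵁ cechOpen 𝓤 s ⊓ q ⁻¹ᵁ cechOpen 𝓥 t))
      map := fun {t t'} h => ModuleCat.ofHom (SecMod.res G ρ (boxOpen_anti p q 𝓤 𝓥 subset_rfl h.le))
      map_id := fun t => by ext x; exact SecMod.res_self _ x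
      map_comp := fun {t t' t''} f g => by
        ext x
        change SecMod.res G ρ _ x = SecMod.res G ρ _ (SecMod.res G ρ _ x)
        rw [SecMod.res_res] }
  map {s s'} h :=
    { app := fun t => ModuleCat.ofHom (SecMod.res G ρ (boxOpen_anti p q 𝓤 𝓥 h.le subset_rfl))
      naturality := fun {t t'} k => by
        ext x
        change SecMod.res G ρ _ (SecMod.res G ρ _ x) = SecMod.res G ρ _ (SecMod.res G ρ _ x)
        rw [SecMod.res_res, SecMod.res_res] }
  map_id s := by ext t x; exact SecMod.res_self _ x
  map_comp {s s' s''} f g := by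
    ext t x
    change SecMod.res G ρ _ x = SecMod.res G ρ _ (SecMod.res G ρ _ x)
    rw [SecMod.res_res]

/-- Restriction in `t` (`rfl`). [cite: StacksProject, Tag 0BEC] -/
theorem boxSectionsSystem_obj_map_apply (s : Finset ι) {t t' : Finset κ} (h : t ⟶ t')
    (x : SecMod G ρ (p ⁻¹ᵁ cechOpen 𝓤 s ⊓ q ⁻¹ᵁ cechOpen 𝓥 t)) :
    (((boxSectionsSystem p q 𝓤 𝓥 G ρ).obj s).map h).hom x =
      SecMod.res G ρ (boxOpen_anti p q 𝓤 𝓥 subset_rfl h.le) x := rfl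

/-- Restriction in `s` (`rfl`). [cite: StacksProject, Tag 0BEC] -/
theorem boxSectionsSystem_map_app_apply {s s' : Finset ι} (h : s ⟶ s') (t : Finset κ)
    (x : SecMod G ρ (p ⁻¹ᵁ cechOpen 𝓤 s ⊓ q ⁻¹ᵁ cechOpen 𝓥 t)) :
    (((boxSectionsSystem p q 𝓤 𝓥 G ρ).map h).app t).hom x =
      SecMod.res G ρ (boxOpen_anti p q 𝓤 𝓥 h.le subset_rfl) x := rfl

variable [LinearOrder ι] [LinearOrder κ]

/-- **The Čech bicomplex `Č•,•(p⁻¹𝓤, q⁻¹𝓥; G)`** of an `𝒪_Z`-module on the pair of pulled-back families of opens: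
`Čᵃ,ᵇ = Π_{τ ∈ Simplex κ b} Π_{σ ∈ Simplex ι a} Γ(G, p⁻¹U_σ ∩ q⁻¹V_τ)` with both ordered Čech differentials (the double
complex of Stacks 0BEC; `OrderedCech.sysBicomplex` of the pair-system of sections). [cite: StacksProject, Tag 0BEC]
[cite: StacksProject, Tag 012K] -/
abbrev cechBoxBicomplex : HomologicalComplex₂ (ModuleCat.{u} A) (ComplexShape.up ℤ) (ComplexShape.up ℤ) :=
  sysBicomplex (boxSectionsSystem p q 𝓤 𝓥 G ρ)
end System

section Box

variable {E : X.Modules} {F : Y.Modules} [IsAffine S] [LinearOrder ι] [LinearOrder κ] [Fintype ι] [Fintype κ]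

section Naturality
variable (H : IsPullback p q iX iY) (hU : ∀ s : Finset ι, s.Nonempty → IsAffineOpen (cechOpen 𝓤 s))
  (hV : ∀ t : Finset κ, t.Nonempty → IsAffineOpen (cechOpen 𝓥 t)) (hE : IsAffineLocalizing E)
  (hF : IsAffineLocalizing F) (φ : A ≃+* Γ(S, ⊤))

omit [IsAffine S] [LinearOrder ι] [LinearOrder κ] [Fintype ι] [Fintype κ] in
/-- Restriction in `s` on `Γ(U_s, E) ⊗ Γ(V_t, F)` is `res ⊗ res_{V_t ≤ V_t}` (`SecMod.res_self`). [cite: GortzWedhorn2023, Def. 21.68 (p. 180)] -/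
theorem whiskerRight_sections_apply {s s' : Finset ι} (h : s ⟶ s') (t : Finset κ) (ρX : A →+* Γ(X, ⊤))
    (ρY : A →+* Γ(Y, ⊤)) (x : SecMod E ρX (cechOpen 𝓤 s) ⊗[A] SecMod F ρY (cechOpen 𝓥 t)) :
    ((sectionsSystem 𝓤 E ρX).map h ▷ (sectionsSystem 𝓥 F ρY).obj t).hom x =
      TensorProduct.map (SecMod.res E ρX (cechOpen_anti 𝓤 h.le)) (SecMod.res F ρY le_rfl) x := by
  induction x using TensorProduct.induction_on with
  | zero => simp only [map_zero]
  | tmul m n => rw [ModuleCat.MonoidalCategory.whiskerRight_apply, TensorProduct.map_tmul, SecMod.res_self]; rfl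
  | add x y hx hy => simp only [map_add, hx, hy]
omit [IsAffine S] [LinearOrder ι] [LinearOrder κ] [Fintype ι] [Fintype κ] in
/-- Restriction in `t` on `Γ(U_s, E) ⊗ Γ(V_t, F)` is `res_{U_s ≤ U_s} ⊗ res` (`SecMod.res_self`). [cite: GortzWedhorn2023, Def. 21.68 (p. 180)] -/
theorem whiskerLeft_sections_apply (s : Finset ι) {t t' : Finset κ} (h : t ⟶ t') (ρX : A →+* Γ(X, ⊤))
    (ρY : A →+* Γ(Y, ⊤)) (x : SecMod E ρX (cechOpen 𝓤 s) ⊗[A] SecMod F ρY (cechOpen 𝓥 t)) :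
    ((sectionsSystem 𝓤 E ρX).obj s ◁ (sectionsSystem 𝓥 F ρY).map h).hom x =
      TensorProduct.map (SecMod.res E ρX le_rfl) (SecMod.res F ρY (cechOpen_anti 𝓥 h.le)) x := by
  induction x using TensorProduct.induction_on with
  | zero => simp only [map_zero]
  | tmul m n => rw [ModuleCat.MonoidalCategory.whiskerLeft_apply, TensorProduct.map_tmul, SecMod.res_self]; rfl
  | add x y hx hy => simp only [map_add, hx, hy]

omit [LinearOrder ι] [LinearOrder κ] [Fintype ι] [Fintype κ] in
/-- Naturality of `boxTensorSecModEquiv⁻¹` in `s` (from `boxTensorSecModEquiv_natural`). [cite: GortzWedhorn2020, Rem. 7.25] -/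
theorem boxTensorSecModEquiv_symm_natural_fst {s s' : Finset ι} (t : Finset κ) (hs : s.Nonempty) (hs' : s'.Nonempty)
    (ht : t.Nonempty) (h : s ⊆ s')
    (x : SecMod E (overRingHom iX φ) (cechOpen 𝓤 s) ⊗[A] SecMod F (overRingHom iY φ) (cechOpen 𝓥 t)) :
    (boxTensorSecModEquiv H (hU s' hs') (hV t ht) rfl hE hF φ).symm
        (TensorProduct.map (SecMod.res E _ (cechOpen_anti 𝓤 h)) (SecMod.res F _ le_rfl) x) =
      SecMod.res (boxTensor p q E F) (overRingHom (p ≫ iX) φ) (boxOpen_anti p q 𝓤 𝓥 h subset_rfl)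
        ((boxTensorSecModEquiv H (hU s hs) (hV t ht) rfl hE hF φ).symm x) := by
  rw [LinearEquiv.symm_apply_eq, boxTensorSecModEquiv_natural H (hU s hs) (hV t ht) (hU s' hs') (hV t ht) rfl rfl
    hE hF φ (cechOpen_anti 𝓤 h) le_rfl _, LinearEquiv.apply_symm_apply]

omit [LinearOrder ι] [LinearOrder κ] [Fintype ι] [Fintype κ] in
/-- Naturality of `boxTensorSecModEquiv⁻¹` in `t` (from `boxTensorSecModEquiv_natural`). [cite: GortzWedhorn2020, Rem. 7.25] -/
theorem boxTensorSecModEquiv_symm_natural_snd (s : Finset ι) {t t' : Finset κ} (hs : s.Nonempty) (ht : t.Nonempty)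
    (ht' : t'.Nonempty) (h : t ⊆ t')
    (x : SecMod E (overRingHom iX φ) (cechOpen 𝓤 s) ⊗[A] SecMod F (overRingHom iY φ) (cechOpen 𝓥 t)) :
    (boxTensorSecModEquiv H (hU s hs) (hV t' ht') rfl hE hF φ).symm
        (TensorProduct.map (SecMod.res E _ le_rfl) (SecMod.res F _ (cechOpen_anti 𝓥 h)) x) =
      SecMod.res (boxTensor p q E F) (overRingHom (p ≫ iX) φ) (boxOpen_anti p q 𝓤 𝓥 subset_rfl h)
        ((boxTensorSecModEquiv H (hU s hs) (hV t ht) rfl hE hF φ).symm x) := by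
  rw [LinearEquiv.symm_apply_eq, boxTensorSecModEquiv_natural H (hU s hs) (hV t ht) (hU s hs) (hV t' ht') rfl rfl
    hE hF φ le_rfl (cechOpen_anti 𝓥 h) _, LinearEquiv.apply_symm_apply]
end Naturality

/-- **`Č•,•(Γ(𝓤, E) ⊠ Γ(𝓥, F)) ≅ Č•,•(p⁻¹𝓤, q⁻¹𝓥; E ⊠ F)`** — termwise the affine sections formula `boxTensorSecModEquiv`
(Görtz–Wedhorn I Prop. 4.17, Prop. 7.24 (2), Cor. 7.19 (4)) on non-empty `s`, `t`, assembled by `sysBicomplexIsoNE`; naturality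
in each variable is `boxTensorSecModEquiv_natural`. [cite: StacksProject, Tag 0BEC] [cite: GortzWedhorn2020, Cor. 7.19 (4) and Prop. 7.24 (2)] -/
def cechBoxBicomplexIso (H : IsPullback p q iX iY) (hU : ∀ s : Finset ι, s.Nonempty → IsAffineOpen (cechOpen 𝓤 s))
    (hV : ∀ t : Finset κ, t.Nonempty → IsAffineOpen (cechOpen 𝓥 t)) (hE : IsAffineLocalizing E)
    (hF : IsAffineLocalizing F) (φ : A ≃+* Γ(S, ⊤)) :
    sysBicomplex (prodSystem (sectionsSystem 𝓤 E (overRingHom iX φ)) (sectionsSystem 𝓥 F (overRingHom iY φ))) ≅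
      cechBoxBicomplex p q 𝓤 𝓥 (boxTensor p q E F) (overRingHom (p ≫ iX) φ) :=
  sysBicomplexIsoNE
    (fun s t hs ht => (boxTensorSecModEquiv H (hU s hs) (hV t ht) rfl hE hF φ).symm)
    (fun s s' t hs hs' ht h x => by
      change (boxTensorSecModEquiv H (hU s' hs') (hV t ht) rfl hE hF φ).symm
          (((sectionsSystem 𝓤 E (overRingHom iX φ)).map (homOfLE h) ▷
            (sectionsSystem 𝓥 F (overRingHom iY φ)).obj t).hom x) =
        SecMod.res (boxTensor p q E F) (overRingHom (p ≫ iX) φ) (boxOpen_anti p q 𝓤 𝓥 h subset_rfl)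
          ((boxTensorSecModEquiv H (hU s hs) (hV t ht) rfl hE hF φ).symm x)
      rw [whiskerRight_sections_apply]
      exact boxTensorSecModEquiv_symm_natural_fst 𝓤 𝓥 H hU hV hE hF φ t hs hs' ht h x)
    (fun s t t' hs ht ht' h x => by
      change (boxTensorSecModEquiv H (hU s hs) (hV t' ht') rfl hE hF φ).symm
          (((sectionsSystem 𝓤 E (overRingHom iX φ)).obj s ◁
            (sectionsSystem 𝓥 F (overRingHom iY φ)).map (homOfLE h)).hom x) =
        SecMod.res (boxTensor p q E F) (overRingHom (p ≫ iX) φ) (boxOpen_anti p q 𝓤 𝓥 subset_rfl h)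
          ((boxTensorSecModEquiv H (hU s hs) (hV t ht) rfl hE hF φ).symm x)
      rw [whiskerLeft_sections_apply]
      exact boxTensorSecModEquiv_symm_natural_snd 𝓤 𝓥 H hU hV hE hF φ s hs ht ht' h x)

/-- **`Č(𝓤, E) ⊗_A Č(𝓥, F) ≅ Tot Č•,•(p⁻¹𝓤, q⁻¹𝓥; E ⊠ F)`**: Mathlib's tensor product of the module Čech complexes
(`Modules.cechComplex`) is the total complex of the Čech bicomplex of `E ⊠ F` on the opens `U_s ×_S V_t` — the double complex of
the proof of the Künneth formula, Stacks 0BEC. [cite: StacksProject, Tag 0BEC] [cite: StacksProject, Tag 012K] -/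
def cechTensorIsoTotal (H : IsPullback p q iX iY) (hU : ∀ s : Finset ι, s.Nonempty → IsAffineOpen (cechOpen 𝓤 s))
    (hV : ∀ t : Finset κ, t.Nonempty → IsAffineOpen (cechOpen 𝓥 t)) (hE : IsAffineLocalizing E)
    (hF : IsAffineLocalizing F) (φ : A ≃+* Γ(S, ⊤)) :
    HomologicalComplex.tensorObj (cechComplex 𝓤 E (overRingHom iX φ)) (cechComplex 𝓥 F (overRingHom iY φ)) ≅
      (cechBoxBicomplex p q 𝓤 𝓥 (boxTensor p q E F) (overRingHom (p ≫ iX) φ)).total (ComplexShape.up ℤ) :=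
  totalTensorIso (sectionsSystem 𝓤 E (overRingHom iX φ)) (sectionsSystem 𝓥 F (overRingHom iY φ)) ≪≫
    HomologicalComplex₂.total.mapIso (cechBoxBicomplexIso 𝓤 𝓥 H hU hV hE hF φ) (ComplexShape.up ℤ)

end Box

end Literature.AlgebraicGeometry.Modules
end
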